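/-
Copyright (c) 2026 the pub-hodgecm-mathlib formalisation cell (harness21).  Prover seat hodgecm-mathlib-LH4-p19 (g0), req620 Track A «(D-RAM) FOUR-FRAME» squad
(STAGE-1b, row (2) of the piece `f_{T₊}`, the (β₂) road (R-36) «PURE-CELL LEDGER»; β₂ sub-dealer LH4-p04 (g8) BETA2-BOARD v1.1 row (L-D×); the SHARP δ-threshold of the clean
regime, read off the d = 4 reduced model `F0/P3c/LH4/LH4-p19/g0/dcell_d4.v1.LH4p19g0.py`), 2026-09-04.
-/
import Summits.HodgeConjecture.HodgeConjecture.Theorems.F0P3cDyRamDiagonalCellCleanRegime   -- ★ p861813 (this seat): §1–§6 (`exists_fixed_unit_hlamE`, `exists_eq_pow_mul_map_add`, `v_map_le_pow_iff`, `v_eq_pow_of_map_eq`, `v_varpi_pow_le_pow`)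
import HarnessLib

/-!
# Crux `H413`, line LH4 «(D-RAM) FOUR-FRAME» — STAGE-1b, row (2), the (β₂) road (R-36), row (L-D×): «THE SHARP CLEAN REGIME OF THE DIAGONAL CELL» — with the ramified
# `Θ`-datum on `M` the unitarity cross term `Tr_Θ(θ·Θlam)` gains `d − 1` digits, so the clean letter `hlam` of ★ p861637 holds as soon as `d` is even, `m ≥ 3d − 2` and
# **`δ ≥ m* = 2d − 1`** (★ p861813: `δ ≥ 3d − 2`; the model at `d = 4`, `m = 10`: antisymmetric-pure from `δ = 8`, balanced at `δ ∈ {2, 4, 6}`)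

Cell `hodgecm-mathlib` (D-0151), FLOOR 0, crux item H413 = `stmt-HodgeConjecture-24833`, route of record `HCCMUnconditional`; squad F0∕P3c∕LH4; lane
`--supports stmt-HodgeConjecture-24833 --as helper` (count-neutral; pays NO tier-0 row).  THEOREMS ONLY (no `def`, no instance, no notation, no `sorry`, default heartbeats);
★-only imports; states NO law; (β₂) stays a HYPOTHESIS.  DATUM-FREE local algebra in ★ p861813's letters plus the ramified `Θ`-datum `IsRamifiedQuadraticDatum Θ (jE ϖ) d t′` on
`M` (the `hDΘ` of ★ p857929's RamK block ∕ LH4-p04 (g8)'s `beta2CellsBFrame`).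
* §1 `v_map_norm_sub_one_le_of_datum` — ★ §5 SHARPENED: `Θ(lam)·lam = 1`, `|lam| = 1`, `|lam − jE x| ≤ |jEϖ|^n`, `d − 1 ≤ n` ⟹ `|jE(x·σx) − 1| ≤ |jEϖ|^{n + d − 1}`
  (`jE(xσx) − 1 = −Tr_Θ(θ·Θlam) + N_Θ(θ)`, `θ = lam − jE x`; ★ `v_add_map_le_exp` on `M`).
* §2 HEAD `exists_fixed_unit_hlam_of_depths_sharp` — ★ p861813 §6 with §1 in place of ★ §5: `d` even, `m* + d − 1 ≤ 2b`, **`m* ≤ δ`** ⟹ `∃ f`, `σ f = f`, `|f| = 1`,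
  `|lam − jE u₀₀ + jE(f·t₊·(ϖσϖ)^b)| ≤ |jEϖ|^{2b + m*}` — the `hlam`∕`hft`∕`hσf`∕`hf1` letters of ★ p861637 ∕ ★ p861633, ONE `f` for both literals.
REGIME MAP OF THE DIAGONAL CELL (model evidence d = 2 engine + d = 4 reduced model; proofs: this file + ★ p861637∕p861633 for the last line only):
`δ = 0` literal-SYMMETRIC ((L-EQ)); `1 ≤ δ ≤ 2d − 2` BALANCED on each literal (OPEN, an (L-P)-type row); `δ ≥ 2d − 1` (and `m ≥ 3d − 2`, a V-shrink) PURE and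
literal-ANTISYMMETRIC (★).
HONEST LABEL.  Count-neutral local algebra; nothing printed is asserted; no census law is stated; `HC_CM` is proved only modulo the 7 printed citations (2 remaining named inputs:
hLiu418 = `stmt-HodgeConjecture-24832`, h413 = `stmt-HodgeConjecture-24833`) until rung 0 closes.
## References
* [Serre1979] J.-P. Serre, *Local Fields*, GTM 67 (1979): Ch. III §3 Prop. 7 (trace ideals), Ch. III §6 Prop. 12, Ch. V §3 Cor. 3.
* [Jacobowitz1962] R. Jacobowitz, *Hermitian forms over local fields*, Amer. J. Math. 84 (1962): §4.
* [Rogawski1990] J. D. Rogawski, *Automorphic Representations of Unitary Groups in Three Variables*, Ann. of Math. Stud. 123 (1990): §4.9 Prop. 4.9.1 (b) p. 55, §12.2.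
-/

set_option autoImplicit false

noncomputable section

namespace Summit.HodgeConjecture.HodgeConjecture.Cruxes.H413.F0P3cDyRamDiagonalCellCleanRegimeSharp

open scoped Valued WithZero
open WithZero
open Literature.NumberTheory.Automorphic.UnitaryThreeFourFrame (IsRamifiedQuadraticDatum)
open Literature.NumberTheory.LocalFields.WildQuadraticDatum (v_add_map_le_exp v_varpi_pow)
open Summit.HodgeConjecture.HodgeConjecture.Cruxes.H413.F0P3cDyRamFourFramePieces (mstarOfRecord)
open Summit.HodgeConjecture.HodgeConjecture.Cruxes.H413.F0P3cDyRamDiagonalCellCleanRegime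

variable {E M : Type} [Field E] [Valued E ℤᵐ⁰] [Field M] [Valued M ℤᵐ⁰] {ρ Θ : M →+* M} {α : M}

/-! ## §1 The norm equation with the trace-ideal gain on `M` -/

omit [Valued E ℤᵐ⁰] in
/-- **THE NORM EQUATION TO DEPTH `n + d − 1`**: at a ramified `Θ`-datum `IsRamifiedQuadraticDatum Θ ϖM d t′` on `M` (`ϖM = jE ϖ`), if `Θ(lam)·lam = 1`, `|lam| = 1`,
`Θ ∘ jE = jE ∘ σ` and `|lam − jE x| ≤ |ϖM|^n` with `d − 1 ≤ n`, then `|jE(x·σx) − 1| ≤ |ϖM|^{n + d − 1}`:  `jE(xσx) − 1 = −(θ·Θlam + Θ(θ·Θlam)) + θ·Θθ` with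
`θ = lam − jE x`, the trace gaining `d − 1` digits (★ `v_add_map_le_exp`: `Tr_Θ 𝔭^n ⊆ 𝔭^{2⌊(n+d)∕2⌋}`) and `|θΘθ| ≤ |ϖM|^{2n}`. [cite: Serre1979, Ch. III §3 Prop. 7] [cite: Jacobowitz1962, §4] -/
theorem v_map_norm_sub_one_le_of_datum (σ : E →+* E) (jE : E →+* M) {ϖ : E} {d t' : ℕ} (hDM : IsRamifiedQuadraticDatum Θ (jE ϖ) d t')
    (hΘj : ∀ c, Θ (jE c) = jE (σ c)) {lam : M} (hΘlam : Θ lam * lam = 1) (hlam1 : Valued.v lam = 1)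
    {x : E} {n : ℕ} (hn : d - 1 ≤ n) (hx : Valued.v (lam - jE x) ≤ Valued.v (jE ϖ) ^ n) :
    Valued.v (jE (x * σ x) - 1) ≤ Valued.v (jE ϖ) ^ (n + d - 1) := by
  obtain ⟨hΘΘ, hvΘ, hϖM, hfix, hdd, hd1, ht⟩ := hDM
  set θ : M := lam - jE x with hθ
  have hjx : jE x = lam - θ := by rw [hθ]; ring
  have hkey : jE (x * σ x) - 1 = -(θ * Θ lam + Θ (θ * Θ lam)) + θ * Θ θ := by
    rw [map_mul, ← hΘj, hjx, map_sub, map_mul, hΘΘ]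
    linear_combination hΘlam
  rw [hkey]
  have hvθ : Valued.v θ ≤ Valued.v (jE ϖ) ^ n := hx
  have hπ1 : Valued.v (jE ϖ) ≤ 1 := by rw [hϖM, ← exp_zero, exp_le_exp]; norm_num
  refine (Valuation.map_add _ _ _).trans (max_le ?_ ?_)
  · rw [Valuation.map_neg]
    have hw : Valued.v (θ * Θ lam) ≤ exp (-(n : ℤ)) := by
      rw [← v_varpi_pow hϖM, Valuation.map_mul, hvΘ, hlam1, mul_one]; exact hvθ
    have h1 := v_add_map_le_exp hΘΘ hfix hϖM hdd ht (x := θ * Θ lam) (j := (n : ℤ)) (m := (((n + d) / 2 : ℕ) : ℤ)) hw (by omega)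
    rw [v_varpi_pow hϖM]
    refine h1.trans (exp_le_exp.2 ?_)
    omega
  · rw [Valuation.map_mul, hvΘ]
    calc Valued.v θ * Valued.v θ ≤ Valued.v (jE ϖ) ^ n * Valued.v (jE ϖ) ^ n := by gcongr
      _ = Valued.v (jE ϖ) ^ (n + n) := by rw [pow_add]
      _ ≤ Valued.v (jE ϖ) ^ (n + d - 1) := pow_le_pow_right_of_le_one' hπ1 (by omega)

/-! ## §2 HEAD — the clean letter from the depths, sharp threshold `δ ≥ m*` -/

/-- **HEAD — «THE SHARP CLEAN REGIME OF THE DIAGONAL CELL»: `d` EVEN, `m* + d − 1 ≤ 2b`, `m* ≤ δ` ⟹ `∃ f`, `σ f = f`, `|f| = 1`,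
`|lam − jE u₀₀ + jE(f·t₊·(ϖσϖ)^b)| ≤ |jEϖ|^{2b + m*}`** — ★ p861813 §6's letters plus the ramified `Θ`-datum `hDM : IsRamifiedQuadraticDatum Θ (jE ϖ) d t′` on `M` (★
p857929's RamK block), the δ-threshold lowered from `m* + d − 1` to `m*` by §1.  Route: ★ §4 (E-approximant `μ = jE μ_E + ϖE^{2b+δ}y`) → §1 (`|N(u₀₀ + μ_E) − 1| ≤ |ϖ|^{2b+δ+d−1}`) →
★ §3 at the shifted gap `δ + d − 1`.  At `d = 2`: `m ≥ 4 ∧ δ ≥ 3` (engine: `δ ≥ 4`, odd δ unreachable); at `d = 4`: `m ≥ 10 ∧ δ ≥ 7` (reduced model: antisymmetric from `δ = 8`,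
balanced at `δ ≤ 6`). [cite: Serre1979, Ch. III §6 Prop. 12] [cite: Serre1979, Ch. III §3 Prop. 7] [cite: Jacobowitz1962, §4] [cite: Rogawski1990, §4.9 Prop. 4.9.1 (b) p. 55] -/
theorem exists_fixed_unit_hlam_of_depths_sharp {σ : E →+* E} {ϖ : E} {d t t' : ℕ} (hD : IsRamifiedQuadraticDatum σ ϖ d t) (hd2 : d % 2 = 0)
    (hρρ : ∀ x, ρ (ρ x) = x) (hα : ρ α ≠ α) (hα1 : Valued.v α ≤ 1) (hint : ∀ z : M, Valued.v z ≤ 1 → Valued.v ((z - ρ z) / (α - ρ α)) ≤ 1)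
    (jE : E →+* M) (hjv : ∀ c, Valued.v (jE c) ≤ 1 ↔ Valued.v c ≤ 1) (hjfix : ∀ z, ρ z = z ↔ ∃ c, jE c = z)
    (hDM : IsRamifiedQuadraticDatum Θ (jE ϖ) d t') (hΘj : ∀ c, Θ (jE c) = jE (σ c))
    {lam : M} (hΘlam : Θ lam * lam = 1) (hlam1 : Valued.v lam = 1)
    {u : E} (huu : u * σ u = 1) (hu1 : Valued.v (u - 1) ≤ Valued.v ϖ ^ mstarOfRecord d)
    {b δ : ℕ} (hm : Valued.v (lam - jE u) = Valued.v (jE ϖ) ^ (2 * b))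
    (hjl : Valued.v ((lam - jE u) - ρ (lam - jE u)) ≤ Valued.v (jE ϖ ^ (2 * b + δ) * (α - ρ α)))
    (hb : mstarOfRecord d + d - 1 ≤ 2 * b) (hδ : mstarOfRecord d ≤ δ) :
    ∃ f : E, σ f = f ∧ Valued.v f = 1 ∧
      Valued.v (lam - jE u + jE (f * ((ϖ - σ ϖ) * ((ϖ * σ ϖ) ^ ((d - d % 2) / 2))⁻¹) * (ϖ * σ ϖ) ^ b)) ≤ Valued.v (jE ϖ) ^ (2 * b + mstarOfRecord d) := by
  have hϖ := hD.2.2.1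
  have hd1 : 1 ≤ d := hD.2.2.2.2.2.1
  have hvϖ0 : Valued.v ϖ ≠ 0 := by rw [hϖ]; exact exp_ne_zero
  have hϖ0 : ϖ ≠ 0 := fun h0 => by rw [h0, map_zero] at hvϖ0; exact hvϖ0 rfl
  have hπ0 : jE ϖ ≠ 0 := (map_ne_zero jE).2 hϖ0
  have hπ1 : Valued.v (jE ϖ) ≤ 1 := (hjv ϖ).2 (by rw [hϖ, ← exp_zero, exp_le_exp]; norm_num)
  have hρπ : ρ (jE ϖ) = jE ϖ := (hjfix _).2 ⟨ϖ, rfl⟩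
  have hδ1 : 1 ≤ δ := le_trans (show 1 ≤ mstarOfRecord d by simp only [mstarOfRecord]; omega) hδ
  set μ : M := lam - jE u with hμdef
  -- ★ §4: the E-approximant
  obtain ⟨e, y, he1, hy1, hμey⟩ := exists_eq_pow_mul_map_add hρρ hα hα1 hint jE hjfix hρπ hπ0 hπ1 hm.le hjl
  set μE : E := ϖ ^ (2 * b) * e with hμEdef
  have hjμE : jE μE = jE ϖ ^ (2 * b) * jE e := by rw [hμEdef, map_mul, map_pow]
  have hθ : μ - jE μE = jE ϖ ^ (2 * b + δ) * y := by rw [hμey, hjμE]; ring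
  have hvθ : Valued.v (μ - jE μE) ≤ Valued.v (jE ϖ) ^ (2 * b + δ) := by
    rw [hθ, Valuation.map_mul, Valuation.map_pow]
    calc Valued.v (jE ϖ) ^ (2 * b + δ) * Valued.v y ≤ Valued.v (jE ϖ) ^ (2 * b + δ) * 1 := by gcongr
      _ = _ := mul_one _
  have hπlt : Valued.v (jE ϖ) < 1 := by
    refine lt_of_le_of_ne hπ1 fun h1 => ?_
    have h0 := v_eq_pow_of_map_eq jE hjv hϖ0 (c := ϖ) (n := 0) (by rw [pow_zero, h1])
    rw [pow_zero, hϖ, ← exp_zero] at h0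
    exact absurd (exp_injective h0) (by norm_num)
  have hvμE : Valued.v μE = Valued.v ϖ ^ (2 * b) := by
    refine v_eq_pow_of_map_eq jE hjv hϖ0 ?_
    have hlt : Valued.v (-(μ - jE μE)) < Valued.v μ := by
      rw [Valuation.map_neg, hm]
      refine lt_of_le_of_lt hvθ ?_
      exact pow_lt_pow_right_of_lt_one₀ (zero_lt_iff.2 ((Valuation.ne_zero_iff _).2 hπ0)) hπlt (Nat.lt_add_of_pos_right hδ1)
    have h2 : jE μE = μ + -(μ - jE μE) := by ring
    rw [h2, Valuation.map_add_eq_of_lt_left _ hlt, hm]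
  -- §1: the norm equation at the SHIFTED gap `δ + d − 1`
  have hxθ : Valued.v (lam - jE (u + μE)) ≤ Valued.v (jE ϖ) ^ (2 * b + δ) := by
    have : lam - jE (u + μE) = μ - jE μE := by rw [hμdef, map_add]; ring
    rw [this]; exact hvθ
  have hN' := v_map_norm_sub_one_le_of_datum σ jE hDM hΘj hΘlam hlam1 (n := 2 * b + δ) (by omega) hxθ
  have hN : Valued.v ((u + μE) * σ (u + μE) - 1) ≤ Valued.v ϖ ^ (2 * b + (δ + d - 1)) := by
    refine (v_map_le_pow_iff jE hjv hϖ0 _ _).1 ?_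
    rw [map_sub, map_one]
    have h2 : 2 * b + (δ + d - 1) = 2 * b + δ + d - 1 := by omega
    rw [h2]; exact hN'
  -- ★ §3 on `E` with the shifted gap
  obtain ⟨f, hσf, hf1, hfE⟩ := exists_fixed_unit_hlamE hD hd2 huu hu1 hvμE hN hb (by omega)
  refine ⟨f, hσf, hf1, ?_⟩
  have hfM : Valued.v (jE (μE + f * ((ϖ - σ ϖ) * ((ϖ * σ ϖ) ^ ((d - d % 2) / 2))⁻¹) * (ϖ * σ ϖ) ^ b)) ≤ Valued.v (jE ϖ) ^ (2 * b + mstarOfRecord d) :=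
    (v_map_le_pow_iff jE hjv hϖ0 _ _).2 hfE
  have hsplit : μ + jE (f * ((ϖ - σ ϖ) * ((ϖ * σ ϖ) ^ ((d - d % 2) / 2))⁻¹) * (ϖ * σ ϖ) ^ b) =
      (μ - jE μE) + jE (μE + f * ((ϖ - σ ϖ) * ((ϖ * σ ϖ) ^ ((d - d % 2) / 2))⁻¹) * (ϖ * σ ϖ) ^ b) := by rw [map_add]; ring
  rw [hsplit]
  exact (Valuation.map_add _ _ _).trans (max_le (hvθ.trans (pow_le_pow_right_of_le_one' hπ1 (by omega))) hfM)

end Summit.HodgeConjecture.HodgeConjecture.Cruxes.H413.F0P3cDyRamDiagonalCellCleanRegimeSharp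

end
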